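import Mathlib.Tactic.NormNum.LegendreSymbol
import Literature.NumberTheory.QuadraticFields.BakerTwoLogValues
import HarnessLib

/-!
# `X₂₁ = 2 log ε₂₁`, `X₃₃ = 2 log ε₃₃`: the class numbers of `ℚ(√21)`, `ℚ(√33)` are `1`

Topic `NumberTheory/QuadraticFields`, namespace `Literature.NumberTheory.QuadraticFields.BakerLimitFormula`.
Everything here is PROVED.

Baker 1975, Ch. 5 §4 (p. 50): "`L(1, χ) = 2h(k) log ε_k/√k` … In both cases `h(k) = 1`"
(for `k = 21, 33`). `BakerTwoLogValues.lean` gives `X_k = √k·L(1,(·/k)) = 2h(k) log ε_k` with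
`h(k)` the class number of the real quadratic field of discriminant `k`. Here `h(21) = h(33) = 1`
is obtained *analytically*, without ideal-theoretic input: by the trivial tail bound of the tree
(`DirichletAbel.norm_sum_div_sub_LFunction_one_le_level`: `|∑_{n≤N} χ(n)/n − L(1,χ)| ≤ 2k/(N+1)`)
and the exact partial sums `∑_{n≤84} (n/21)/n`, `∑_{n≤66} (n/33)/n` (evaluated by `norm_num` from
the Jacobi symbols) one has `L(1,(·/21)) < 1.18`, `L(1,(·/33)) < 2.32`, whereas `h(k) ≥ 2` would
force `L(1,(·/k)) = 2h(k) log ε_k/√k ≥ 4 log ε_k/√k`, i.e. `≥ 1.30`, resp. `≥ 2.43`.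

* `bakerX_21_eq` — `bakerX 21 = 2 log ((5 + √21)/2)`;
* `bakerX_33_eq` — `bakerX 33 = 2 log (23 + 4√33)`.

These are exactly the hypotheses `hX21`, `hX33` of
`heegnerStarkPrimeThreeModEight_of_large_above` (`ClassNumberOneBakerMediumRange.lean`).

## References

* A. Baker, *Transcendental Number Theory* (1975), Ch. 5 §4 (p. 50). [Baker1975]
-/

noncomputable section

open Real Complex
open Literature.NumberTheory.QuadraticFields.BakerTwoLog
open scoped NumberTheorySymbols

namespace Literature.NumberTheory.QuadraticFields.BakerLimitFormula

/-- The partial sum `∑_{n ≤ 84} (n/21)/n` of `L(1, (·/21))`, exactly. [folklore] -/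
theorem partialSum_21 :
    ∑ n ∈ Finset.range 84, jacobiChar 21 ((n + 1 : ℕ) : ZMod 21) / ((n : ℂ) + 1) =
      ((1390254134608683590371567710325533 : ℂ) / 2034777262394482676995230613278400) := by
  simp only [Finset.sum_range_succ, Finset.sum_range_zero, jacobiChar_natCast]
  push_cast
  norm_num

/-- The partial sum `∑_{n ≤ 66} (n/33)/n` of `L(1, (·/33))`, exactly. [folklore] -/
theorem partialSum_33 :
    ∑ n ∈ Finset.range 66, jacobiChar 33 ((n + 1 : ℕ) : ZMod 33) / ((n : ℂ) + 1) =
      ((5294815241957595347653143 : ℂ) / 3980696579470782045492800) := by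
  simp only [Finset.sum_range_succ, Finset.sum_range_zero, jacobiChar_natCast]
  push_cast
  norm_num

/-- From `‖S − L‖ ≤ t` and `‖S‖ ≤ s`: `‖L‖ ≤ s + t`. [folklore] -/
theorem norm_le_of_norm_sub_le {S L : ℂ} {s t : ℝ} (h : ‖S - L‖ ≤ t) (hS : ‖S‖ ≤ s) : ‖L‖ ≤ s + t := by
  calc ‖L‖ = ‖S - (S - L)‖ := by ring_nf
    _ ≤ ‖S‖ + ‖S - L‖ := norm_sub_le _ _
    _ ≤ s + t := add_le_add hS h

/-- `|L(1, (·/21))| ≤ 1.18`. [folklore] -/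
theorem norm_LFunction_21_le : ‖(jacobiChar 21).LFunction 1‖ ≤ 59 / 50 := by
  have hχ : jacobiChar 21 ≠ 1 := jacobiChar_ne_one (by decide) squarefree_21 (by norm_num)
  have h := Literature.NumberTheory.LFunctions.DirichletAbel.norm_sum_div_sub_LFunction_one_le_level
    (jacobiChar 21) hχ 84
  rw [partialSum_21] at h
  have hS : ‖((1390254134608683590371567710325533 : ℂ) / 2034777262394482676995230613278400)‖ ≤ 6833 / 10000 := by
    rw [norm_div, Complex.norm_ofNat, Complex.norm_ofNat]; norm_num
  have ht : (2 * ((21 : ℕ) : ℝ) / ((84 : ℕ) + 1)) ≤ 42 / 85 := by norm_num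
  have := norm_le_of_norm_sub_le (h.trans ht) hS
  linarith

/-- `|L(1, (·/33))| ≤ 2.32`. [folklore] -/
theorem norm_LFunction_33_le : ‖(jacobiChar 33).LFunction 1‖ ≤ 58 / 25 := by
  have hχ : jacobiChar 33 ≠ 1 := jacobiChar_ne_one (by decide) squarefree_33 (by norm_num)
  have h := Literature.NumberTheory.LFunctions.DirichletAbel.norm_sum_div_sub_LFunction_one_le_level
    (jacobiChar 33) hχ 66
  rw [partialSum_33] at h
  have hS : ‖((5294815241957595347653143 : ℂ) / 3980696579470782045492800)‖ ≤ 13302 / 10000 := by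
    rw [norm_div, Complex.norm_ofNat, Complex.norm_ofNat]; norm_num
  have ht : (2 * ((33 : ℕ) : ℝ) / ((66 : ℕ) + 1)) ≤ 66 / 67 := by norm_num
  have := norm_le_of_norm_sub_le (h.trans ht) hS
  linarith

/-- **`X₂₁ = 2 log ε₂₁`**, i.e. `h(21) = 1` (Baker 1975, p. 50: "In both cases `h(k) = 1`").
[cite: Baker1975, Ch. 5 §4 (p. 50)] -/
theorem bakerX_21_eq : bakerX 21 = ((2 * Real.log ((5 + Real.sqrt 21) / 2) : ℝ) : ℂ) := by
  obtain ⟨h, _, -, hX⟩ := bakerX_21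
  have hlog := three_half_lt_log_e21
  have he : Real.log ((5 + Real.sqrt 21) / 2) = Real.log e21 := rfl
  rw [he, hX]
  suffices hh : h = 1 by subst hh; push_cast; ring
  by_contra hne
  have h2 : (2 : ℝ) ≤ h := by exact_mod_cast (show 2 ≤ h by omega)
  have hn1 : ‖bakerX 21‖ = 2 * h * Real.log e21 := by
    rw [hX, Complex.norm_real, Real.norm_eq_abs, abs_of_pos (by positivity)]
  have hn2 : ‖bakerX 21‖ ≤ Real.sqrt 21 * (59 / 50) := by
    rw [bakerX_def, norm_mul, Complex.norm_real, Real.norm_eq_abs,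
      abs_of_nonneg (Real.sqrt_nonneg _)]
    have e : Real.sqrt ((21 : ℕ) : ℝ) = Real.sqrt 21 := by norm_num
    rw [e]
    exact mul_le_mul_of_nonneg_left norm_LFunction_21_le (Real.sqrt_nonneg _)
  have hs : Real.sqrt 21 < 4.6 := by nlinarith [sqrt21_sq, Real.sqrt_nonneg 21]
  have h0 : 0 < Real.log e21 := by linarith
  nlinarith

/-- **`X₃₃ = 2 log ε₃₃`**, i.e. `h(33) = 1`. [cite: Baker1975, Ch. 5 §4 (p. 50)] -/
theorem bakerX_33_eq : bakerX 33 = ((2 * Real.log (23 + 4 * Real.sqrt 33) : ℝ) : ℂ) := by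
  obtain ⟨h, _, -, hX⟩ := bakerX_33
  have hlog := seven_half_lt_log_e33
  have he : Real.log (23 + 4 * Real.sqrt 33) = Real.log e33 := rfl
  rw [he, hX]
  suffices hh : h = 1 by subst hh; push_cast; ring
  by_contra hne
  have h2 : (2 : ℝ) ≤ h := by exact_mod_cast (show 2 ≤ h by omega)
  have hn1 : ‖bakerX 33‖ = 2 * h * Real.log e33 := by
    rw [hX, Complex.norm_real, Real.norm_eq_abs, abs_of_pos (by positivity)]
  have hn2 : ‖bakerX 33‖ ≤ Real.sqrt 33 * (58 / 25) := by
    rw [bakerX_def, norm_mul, Complex.norm_real, Real.norm_eq_abs,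
      abs_of_nonneg (Real.sqrt_nonneg _)]
    have e : Real.sqrt ((33 : ℕ) : ℝ) = Real.sqrt 33 := by norm_num
    rw [e]
    exact mul_le_mul_of_nonneg_left norm_LFunction_33_le (Real.sqrt_nonneg _)
  have hs : Real.sqrt 33 < 5.75 := by nlinarith [sqrt33_sq, Real.sqrt_nonneg 33]
  have h0 : 0 < Real.log e33 := by linarith
  nlinarith

end Literature.NumberTheory.QuadraticFields.BakerLimitFormula

end
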